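import Literature.AlgebraicGeometry.Frobenioids.ArchimedeanStandardType
import Literature.AlgebraicGeometry.Frobenioids.ArchimedeanIsometrizationEquivalence
import Literature.AlgebraicGeometry.Frobenioids.ArchimedeanAngularModel
import HarnessLib

/-!
# Frobenioids II, Theorem 3.6 (i), "the canonical decomposition of Definition 3.1 (ii) determines a
# characteristic splitting on `C^Λ`" — PROVED for `Λ = ℤ` (`C = C₀ ×_{D₀} D`) over any base

Mochizuki, *The geometry of Frobenioids II*, Kyushu J. Math. **62** (2008) 401–460, §3, Theorem 3.6 (i),
author's kurims text p. 36 [cite: MochizukiFrdII2008, Thm 3.6 (i) p.36]: "the canonical decomposition of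
Definition 3.1, (ii), determines a characteristic splitting [cf. [Mzk5], Definition 2.3] on `C^Λ`"; proof
p. 38: "it is immediate from the definitions that the canonical decomposition of Definition 3.1, (ii),
determines a characteristic splitting on `C^Λ`."

The generic predicate `ArchFrd.Thm36i_charSplitting F radial` (`ArchimedeanStandardType.lean`: there is a
characteristic splitting `τ` on `F` in the sense of abc-iut-L1-t2's `PreFrobenioid.CharacteristicSplitting`
([FrdI] Def. 2.3) whose submonoids `τ(A)` are, for isotropic `A`, exactly the endomorphisms satisfying
`radial A`) was left uninstantiated by `ArchimedeanTheoremsInstances.lean`. Here (statement owner, seat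
abc-iut-L1-t9) it is INSTANTIATED at `C π` with `radial A t :=` "`t ∈ O^▷(A)` [base-identity, linear] AND
its scalar is a positive real" — the submonoid `Φ^gp(A) × {1} ⊆ Φ^fld(A)` of Thm. 3.6 (iii), i.e. the
factor `ord(K^×)` of the canonical decomposition `O_K^× × ord(K^×) ⥲ K^×` (the bare scalar predicate
`ArchFrd.radial` of the instances file, used in (iii) together with `∈ O^▷(A)`, does not by itself cut out
a submonoid of `O^▷(A)`) — and PROVED: `thm36i_charSplitting_C`. The characteristic splitting: `τ(A)` =
the radial elements of `O^▷(A)`; a subfunctor (scalars of base-identity endomorphisms are untwisted);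
`τ(A) → O^▷(A)/O^×(A)` bijective for isotropic `A` (polar decomposition `c = (c/|c|) · |c|`, the unit
scalars being exactly `O^×(A)`, abc-iut-L6-d7's `ArchimedeanUnitStabilizers`); condition (b): a radial
endomorphism of `A^istr` restricts to `A` (regions are star-shaped). No statement of the paper is
strengthened; nothing here bears on [IUTchIII].
-/

namespace Literature.AlgebraicGeometry.Frobenioids

open CategoryTheory Opposite
open scoped Pointwise

noncomputable section

universe v u

namespace ArchFrd

variable {D : Type u} [Category.{v} D] (π : D ⥤ D0)

/-! ### Radial elements of `O^▷(A)` -/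

/-- The radial elements of `O^▷(A)`: base-identity linear endomorphisms of `A ∈ Ob(C)` whose scalar is a
positive real (the factor `ord(K^×) ≅ ℝ_{>0}` of Def. 3.1 (ii); `Φ^gp(A) × {1} ⊆ Φ^fld(A)`).
[cite: MochizukiFrdII2008, Thm 3.6 (i) p.36] -/
def radialO (A : C π) (t : A ⟶ A) : Prop :=
  t ∈ PreFrobenioid.endSubmonoid (C.toElem π) A ∧ radial π A t

/-- **Thm. 3.6 (i), characteristic-splitting clause, at `C = C^ℤ`** (the printed claim as a `Prop`: a
characteristic splitting on `C` whose submonoids are the radial elements of `O^▷(−)`).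
[cite: MochizukiFrdII2008, Thm 3.6 (i) p.36] -/
def Thm36i_charSplitting_C : Prop := Thm36i_charSplitting (C.toElem π) (radialO π)

/-- The `C₀`-base of a base-identity endomorphism of `C` is the identity.
[cite: MochizukiFrdII2008, Ex 3.3 (i) p.28] -/
theorem base_fst_eq_id_of_snd {A : C π} (t : A ⟶ A) (h : t.snd = 𝟙 A.snd) : C0.Base t.fst = 𝟙 A.fst.base := by
  have hw := t.w
  rw [h, CategoryTheory.Functor.map_id, Category.comp_id] at hw
  exact (cancel_mono A.iso.hom).mp (hw.trans (Category.id_comp _).symm)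

/-- A base-identity endomorphism does not twist scalars. [cite: MochizukiFrdII2008, Ex 3.3 (i) p.28] -/
theorem act_eq_of_snd {A : C π} (t : A ⟶ A) (h : t.snd = 𝟙 A.snd) (u : ℂˣ) : (C0.Base t.fst).act u = u := by
  change D0.galAct (D0.Hom.twists (C0.Base t.fst)) u = u
  rw [base_fst_eq_id_of_snd π t h, D0.twists_id, D0.galAct_false]

/-- A radial scalar is a real scalar, fixed by every Galois twist. [cite: MochizukiFrdII2008, Def 3.1 (ii) p.23] -/
theorem galAct_eq_of_radial {A : C π} {t : A ⟶ A} (ht : radial π A t) (σ : Bool) :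
    D0.galAct σ (C0.scalar t.fst) = C0.scalar t.fst :=
  D0.galAct_eq_self_of_mem_scalars_real σ ((D0.mem_scalars_real_iff _).2 ht.1)

/-- `τ(A)`: the radial elements of `O^▷(A)` as a submonoid of `End(A)` (composition of base-identity linear
endomorphisms multiplies the scalars; positive reals are closed under products).
[cite: MochizukiFrdII2008, Thm 3.6 (i) p.36] -/
def radialSubmonoid (A : C π) : Submonoid (End A) where
  carrier := {t | radialO π A t}
  one_mem' := by
    refine ⟨(PreFrobenioid.endSubmonoid (C.toElem π) A).one_mem, ?_⟩
    change ((C0.scalar (𝟙 A.fst) : ℂˣ) : ℂ).im = 0 ∧ 0 < ((C0.scalar (𝟙 A.fst) : ℂˣ) : ℂ).re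
    rw [C0.scalar_id', Units.val_one]
    exact ⟨Complex.one_im, by rw [Complex.one_re]; exact one_pos⟩
  mul_mem' {f g} hf hg := by
    refine ⟨(PreFrobenioid.endSubmonoid (C.toElem π) A).mul_mem hf.1 hg.1, ?_⟩
    -- `f * g = g ≫ f`; scalar `= Base(g).act(c_f) · c_g ^ deg(f) = c_f · c_g`
    have hdf : C0.degFr f.fst = 1 := hf.1.2
    change ((C0.scalar (g.fst ≫ f.fst) : ℂˣ) : ℂ).im = 0 ∧ 0 < ((C0.scalar (g.fst ≫ f.fst) : ℂˣ) : ℂ).re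
    rw [C0.scalar_comp', act_eq_of_snd π g hg.1.1, hdf, PNat.one_coe, pow_one, Units.val_mul,
      Complex.mul_im, Complex.mul_re, hf.2.1, hg.2.1]
    constructor
    · ring
    · rw [mul_zero, sub_zero]; exact mul_pos hf.2.2 hg.2.2

/-- Membership in `τ(A)`. [cite: MochizukiFrdII2008, Thm 3.6 (i) p.36] -/
theorem mem_radialSubmonoid {A : C π} (t : End A) : t ∈ radialSubmonoid π A ↔ radialO π A t := Iff.rfl

/-! ### The radial endomorphism with a prescribed scalar; the unit automorphism with a prescribed scalar -/

/-- For a linear endomorphism `e` of ANY object of `C`, `|c_e| ≤ 1` (`c · A_A ⊆ A_A` at a boundary point).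
[cite: MochizukiFrdII2008, Ex 3.3 (i) p.27] -/
theorem absHom_scalar_le_one {A : C π} (e : A ⟶ A) (hd : C0.degFr e.fst = 1) :
    absHom ℂ (C0.scalar e.fst) ≤ 1 := by
  have h := C0.norm_scalar_mul_tip_pow_le e.fst
  rw [hd, PNat.one_coe, pow_one] at h
  rw [← Subtype.coe_le_coe, coe_absHom]
  have h' : ‖(C0.scalar e.fst : ℂ)‖ * A.fst.tip ≤ 1 * A.fst.tip := by rw [one_mul]; exact h
  exact le_of_mul_le_mul_right h' A.fst.tip_pos

/-- The radial endomorphism `ρ_r = ((id, 1, r), id)` of `A` (`0 < r ≤ 1`) lies in `τ(A)`.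
[cite: MochizukiFrdII2008, Thm 3.6 (i) p.36] -/
theorem radialEndC_mem (A : C π) (r : PosReal) (hr : r ≤ 1) : radialO π A (radialEndC π A r hr) := by
  refine ⟨⟨rfl, rfl⟩, ?_, ?_⟩
  · exact (D0.mem_scalars_real_iff _).1 (ofPosReal_mem_scalars r .real)
  · change 0 < ((ofPosReal ℂ r : ℂˣ) : ℂ).re
    rw [coe_ofPosReal]
    exact lt_of_lt_of_eq r.2 (Complex.ofReal_re _).symm

/-- The scalar of a radial element of `O^▷(A)`, as a positive real `≤ 1`. [cite: MochizukiFrdII2008, Thm 3.6 (i) p.36] -/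
def radialScalar {A : C π} {t : A ⟶ A} (ht : radialO π A t) : PosReal :=
  ⟨((C0.scalar t.fst : ℂˣ) : ℂ).re, ht.2.2⟩

/-- The scalar of a radial element is the real number `radialScalar`. [cite: MochizukiFrdII2008, Thm 3.6 (i) p.36] -/
theorem scalar_eq_ofPosReal {A : C π} {t : A ⟶ A} (ht : radialO π A t) :
    C0.scalar t.fst = ofPosReal ℂ (radialScalar π ht) :=
  Units.ext (Complex.ext (by rw [coe_ofPosReal]; exact (Complex.ofReal_re _).symm)
    (by rw [coe_ofPosReal, ht.2.1]; exact (Complex.ofReal_im _).symm))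

/-- `radialScalar ≤ 1`. [cite: MochizukiFrdII2008, Thm 3.6 (i) p.36] -/
theorem radialScalar_le_one {A : C π} {t : A ⟶ A} (ht : radialO π A t) : radialScalar π ht ≤ 1 := by
  have h := absHom_scalar_le_one π t ht.1.2
  rw [scalar_eq_ofPosReal π ht, absHom_ofPosReal] at h
  exact h

/-- A radial element of `O^▷(A)` IS the radial endomorphism of its scalar.
[cite: MochizukiFrdII2008, Thm 3.6 (i) p.36] -/
theorem eq_radialEndC {A : C π} {t : A ⟶ A} (ht : radialO π A t) :
    t = radialEndC π A (radialScalar π ht) (radialScalar_le_one π ht) := by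
  refine CFP.hom_ext (C0.hom_ext ?_ ht.1.2 (scalar_eq_ofPosReal π ht)) ht.1.1
  exact base_fst_eq_id_of_snd π t ht.1.1

/-- The unit automorphism `((id, 1, w), id)` of an object with naively isotropic region, for a unit scalar
`w ∈ O_K^×` (complex OR real base). [cite: MochizukiFrdII2008, Thm 3.6 (v) p.37] -/
def unitAutC (A : C π) (hA : A.fst.IsNaivelyIsotropic) (w : ℂˣ) (hw : w ∈ D0.scalars A.fst.base)
    (hn : ‖(w : ℂ)‖ = 1) : A ≅ A :=
  CFP.isoMk
    { hom := C0.homOfNorm A.fst A.fst (𝟙 _) 1 w hw hA (by rw [hn, one_mul, PNat.one_coe, pow_one])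
      inv := C0.homOfNorm A.fst A.fst (𝟙 _) 1 w⁻¹ (inv_mem hw) hA
        (by rw [Units.val_inv_eq_inv_val, norm_inv, hn, inv_one, one_mul, PNat.one_coe, pow_one])
      hom_inv_id := C0.hom_ext (Category.comp_id _) rfl (by
        rw [C0.scalar_comp', C0.scalar_id']
        change D0.galAct (D0.Hom.twists (𝟙 A.fst.base)) w⁻¹ * w ^ ((1 : ℕ+) : ℕ) = 1
        rw [D0.twists_id, D0.galAct_false, PNat.one_coe, pow_one, inv_mul_cancel])
      inv_hom_id := C0.hom_ext (Category.comp_id _) rfl (by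
        rw [C0.scalar_comp', C0.scalar_id']
        change D0.galAct (D0.Hom.twists (𝟙 A.fst.base)) w * w⁻¹ ^ ((1 : ℕ+) : ℕ) = 1
        rw [D0.twists_id, D0.galAct_false, PNat.one_coe, pow_one, mul_inv_cancel]) }
    (Iso.refl A.snd) (by
      change 𝟙 _ ≫ A.iso.hom = A.iso.hom ≫ π.map (𝟙 A.snd)
      rw [CategoryTheory.Functor.map_id, Category.id_comp, Category.comp_id])

/-- `unitAutC ∈ O^×(A)`. [cite: MochizukiFrdII2008, Thm 3.6 (v) p.37] -/
theorem unitAutC_mem (A : C π) (hA : A.fst.IsNaivelyIsotropic) (w : ℂˣ) (hw : w ∈ D0.scalars A.fst.base)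
    (hn : ‖(w : ℂ)‖ = 1) : unitAutC π A hA w hw hn ∈ PreFrobenioid.unitsSubgroup (C.toElem π) A :=
  ⟨rfl, rfl⟩

/-! ### The characteristic splitting -/

/-- Scalars of endomorphisms related through a LINEAR arrow: `φ ≫ β = α ≫ φ` with `β ∈ τ(B)`, `α ∈ O^▷(A)`
forces `c_α = c_β` (the scalars of base-identity endomorphisms are untwisted).
[cite: MochizukiFrdII2008, Thm 3.6 (i) p.36] -/
theorem scalar_eq_of_square {A B : C π} (φ : A ⟶ B) (hφ : PreFrobenioid.IsLinear (C.toElem π) φ)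
    {β : B ⟶ B} (hβ : radialO π B β) {α : A ⟶ A} (hα : α ∈ PreFrobenioid.endSubmonoid (C.toElem π) A)
    (h : φ ≫ β = α ≫ φ) : C0.scalar α.fst = C0.scalar β.fst := by
  have hd : C0.degFr φ.fst = 1 := hφ
  have hdβ : C0.degFr β.fst = 1 := hβ.1.2
  have hs := congrArg (fun k => C0.scalar k.fst) h
  simp only [CFP.comp_fst, C0.scalar_comp'] at hs
  rw [hdβ, hd, PNat.one_coe, pow_one, pow_one, act_eq_of_snd π α hα.1] at hs
  change D0.galAct _ (C0.scalar β.fst) * C0.scalar φ.fst = C0.scalar φ.fst * C0.scalar α.fst at hs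
  rw [galAct_eq_of_radial π hβ.2, mul_comm] at hs
  exact (mul_left_cancel hs).symm

/-- Radiality only depends on the scalar. [cite: MochizukiFrdII2008, Thm 3.6 (i) p.36] -/
theorem radial_of_scalar_eq {A B : C π} {α : A ⟶ A} {β : B ⟶ B} (e : C0.scalar α.fst = C0.scalar β.fst)
    (h : radial π B β) : radial π A α := by
  change ((C0.scalar α.fst : ℂˣ) : ℂ).im = 0 ∧ 0 < ((C0.scalar α.fst : ℂˣ) : ℂ).re
  rw [e]; exact h

/-- Injectivity core of Def. 2.3 (a): radial elements that differ by a unit `γ ∈ O^×(A)` are equal (the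
scalar of `γ` has absolute value `1`, abc-iut-L6-d7). [cite: MochizukiFrdII2008, Thm 3.6 (i) p.36] -/
theorem radial_eq_of_unit_comp {A : C π} {t₁ t₂ : A ⟶ A} (ht₁ : radialO π A t₁) (ht₂ : radialO π A t₂)
    (γ : A ≅ A) (hγ : γ ∈ PreFrobenioid.unitsSubgroup (C.toElem π) A) (h : γ.hom ≫ t₁ = t₂) : t₁ = t₂ := by
  have hs := congrArg (fun k => ((C0.scalar k.fst : ℂˣ) : ℂ)) h
  simp only [CFP.comp_fst, C0.scalar_comp'] at hs
  have hd₁ : C0.degFr t₁.fst = 1 := ht₁.1.2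
  rw [hd₁, PNat.one_coe, pow_one, Units.val_mul] at hs
  change ((D0.galAct _ (C0.scalar t₁.fst) : ℂˣ) : ℂ) * _ = _ at hs
  rw [galAct_eq_of_radial π ht₁.2] at hs
  have hn : ‖((C0.scalar γ.hom.fst : ℂˣ) : ℂ)‖ = 1 := UnitStab.norm_scalar_eq_one π A γ hγ
  have hnorm := congrArg (fun z : ℂ => ‖z‖) hs
  simp only [norm_mul, hn, mul_one] at hnorm
  rw [scalar_eq_ofPosReal π ht₁, scalar_eq_ofPosReal π ht₂, C0.norm_coe_ofPosReal, C0.norm_coe_ofPosReal] at hnorm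
  have hr : radialScalar π ht₁ = radialScalar π ht₂ := Subtype.ext hnorm
  rw [eq_radialEndC π ht₁, eq_radialEndC π ht₂]
  simp only [hr]

/-- Surjectivity core of Def. 2.3 (a): `e = (c/|c|) · |c|` for `e ∈ O^▷(A)`, `A` with naively isotropic
region. [cite: MochizukiFrdII2008, Thm 3.6 (i) p.36] -/
theorem unit_comp_radial_eq {A : C π} (hA : A.fst.IsNaivelyIsotropic) (e : A ⟶ A)
    (hs : e.snd = 𝟙 A.snd) (hd : C0.degFr e.fst = 1) :
    (unitAutC π A hA (unitPart ℂ (C0.scalar e.fst) : ℂˣ) (unitPart_coe_mem_scalars (C0.Hom.scalar_mem e.fst))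
        ((mem_normOneSubgroup_iff ℂ _).1 (unitPart ℂ (C0.scalar e.fst)).2)).hom ≫
      radialEndC π A (absHom ℂ (C0.scalar e.fst)) (absHom_scalar_le_one π e hd) = e := by
  refine CFP.hom_ext (C0.hom_ext ?_ ?_ ?_) ?_
  · rw [CFP.comp_fst, C0.base_comp', base_fst_eq_id_of_snd π e hs]
    exact Category.comp_id _
  · rw [CFP.comp_fst, C0.degFr_comp', hd]; rfl
  · rw [CFP.comp_fst, C0.scalar_comp']
    change D0.galAct (D0.Hom.twists (𝟙 A.fst.base)) (ofPosReal ℂ (absHom ℂ (C0.scalar e.fst))) *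
      (unitPart ℂ (C0.scalar e.fst) : ℂˣ) ^ ((1 : ℕ+) : ℕ) = C0.scalar e.fst
    rw [D0.twists_id, D0.galAct_false, PNat.one_coe, pow_one, mul_comm]
    exact unitPart_mul_ofPosReal_absHom _
  · change 𝟙 _ ≫ 𝟙 _ = e.snd
    rw [Category.comp_id]; exact hs.symm

/-- Condition (b) of Def. 2.3 (and the subfunctor square): a radial `β` on the target of a LINEAR `φ`
is `φ`-related to the radial endomorphism of the source with the same scalar.
[cite: MochizukiFrdII2008, Thm 3.6 (i) p.36] -/
theorem hull_aux {A B : C π} (φ : A ⟶ B) (hd : C0.degFr φ.fst = 1) (β : B ⟶ B) (hβ : radialO π B β) :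
    φ ≫ β = radialEndC π A (radialScalar π hβ) (radialScalar_le_one π hβ) ≫ φ := by
  have hdβ : C0.degFr β.fst = 1 := hβ.1.2
  have hsβ : β.snd = 𝟙 B.snd := hβ.1.1
  refine CFP.hom_ext (C0.hom_ext ?_ ?_ ?_) ?_
  · rw [CFP.comp_fst, CFP.comp_fst, C0.base_comp', C0.base_comp', base_fst_eq_id_of_snd π β hsβ]
    change C0.Base φ.fst ≫ 𝟙 _ = 𝟙 _ ≫ C0.Base φ.fst
    rw [Category.comp_id, Category.id_comp]
  · rw [CFP.comp_fst, CFP.comp_fst, C0.degFr_comp', C0.degFr_comp', hdβ]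
    change C0.degFr φ.fst * 1 = 1 * C0.degFr φ.fst
    rw [mul_one, one_mul]
  · rw [CFP.comp_fst, CFP.comp_fst, C0.scalar_comp', C0.scalar_comp', hdβ, hd, PNat.one_coe, pow_one, pow_one,
      scalar_eq_ofPosReal π hβ]
    change D0.galAct _ (ofPosReal ℂ _) * C0.scalar φ.fst =
      D0.galAct (D0.Hom.twists (𝟙 A.fst.base)) (C0.scalar φ.fst) * ofPosReal ℂ _
    rw [D0.galAct_eq_self_of_mem_scalars_real _ (ofPosReal_mem_scalars _ .real), D0.twists_id, D0.galAct_false,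
      mul_comm]
  · change φ.snd ≫ β.snd = 𝟙 _ ≫ φ.snd
    rw [hsβ, Category.comp_id, Category.id_comp]

/-- **The characteristic splitting of `C` determined by the canonical decomposition** ([FrdI] Def. 2.3):
`τ(A)` = the radial elements of `O^▷(A)`. [cite: MochizukiFrdII2008, Thm 3.6 (i) p.36] -/
def charSplitting : PreFrobenioid.CharacteristicSplitting (C.toElem π) where
  τ := radialSubmonoid π
  τ_le _ := fun _ ht => ht.1
  res_mem {A B} _ _ φ hφ β hβ α hα h :=
    ⟨hα, radial_of_scalar_eq π (scalar_eq_of_square π φ hφ hβ hα h) hβ.2⟩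
  bijective {A} hA := by
    have hAi : A.fst.IsNaivelyIsotropic := (Ex33ii_isotropic_iff_holds π A).1 hA
    constructor
    · rintro ⟨t₁, ht₁⟩ ⟨t₂, ht₂⟩ h
      obtain ⟨u, hu⟩ := Associates.mk_eq_mk_iff_associated.mp h
      obtain ⟨γ, hγ, hγu⟩ := (PreFrobenioid.isUnit_endSubmonoid_iff (C.toElem π)
        (u : PreFrobenioid.endSubmonoid (C.toElem π) A)).mp u.isUnit
      have hprod : (show A ⟶ A from (u : PreFrobenioid.endSubmonoid (C.toElem π) A).1) ≫
          (show A ⟶ A from t₁) = (show A ⟶ A from t₂) :=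
        congrArg (fun e : PreFrobenioid.endSubmonoid (C.toElem π) A => (show A ⟶ A from e.1)) hu
      exact Subtype.ext (radial_eq_of_unit_comp π ht₁ ht₂ γ hγ (hγu ▸ hprod))
    · rintro ⟨⟨e, he⟩⟩
      let γ : A ≅ A := unitAutC π A hAi (unitPart ℂ (C0.scalar e.fst) : ℂˣ)
        (unitPart_coe_mem_scalars (C0.Hom.scalar_mem e.fst)) ((mem_normOneSubgroup_iff ℂ _).1 (unitPart ℂ _).2)
      have hγ : γ ∈ PreFrobenioid.unitsSubgroup (C.toElem π) A := unitAutC_mem π A hAi _ _ _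
      obtain ⟨u, hu⟩ := (PreFrobenioid.isUnit_endSubmonoid_iff (C.toElem π)
        (⟨(γ.hom : End A), hγ⟩ : PreFrobenioid.endSubmonoid (C.toElem π) A)).mpr ⟨γ, hγ, rfl⟩
      have hs : e.snd = 𝟙 A.snd := he.1
      have hd : C0.degFr e.fst = 1 := he.2
      refine ⟨⟨radialEndC π A (absHom ℂ (C0.scalar e.fst)) (absHom_scalar_le_one π e hd), radialEndC_mem π A _ _⟩,
        ?_⟩
      change Associates.mk _ = Associates.mk (⟨e, he⟩ : PreFrobenioid.endSubmonoid (C.toElem π) A)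
      rw [Associates.mk_eq_mk_iff_associated]
      refine ⟨u, Subtype.ext ?_⟩
      rw [Submonoid.coe_mul, hu]
      exact unit_comp_radial_eq π hAi e hs hd
  hull {A B} φ hφ β hβ :=
    ⟨radialEndC π A (radialScalar π hβ) (radialScalar_le_one π hβ), (radialEndC_mem π A _ _).1,
      hull_aux π φ hφ.2.1.1 β hβ⟩

/-- **Theorem 3.6 (i), characteristic-splitting clause, for `C = C^ℤ`** (PROVED over any base
`π : D → D₀`): the radial elements of `O^▷(−)` form a characteristic splitting on `C`.
[cite: MochizukiFrdII2008, Thm 3.6 (i) p.36] -/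
theorem thm36i_charSplitting_C : Thm36i_charSplitting_C π :=
  ⟨charSplitting π, fun _ _ _ => Iff.rfl⟩

end ArchFrd

end

end Literature.AlgebraicGeometry.Frobenioids
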